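import Mathlib.Algebra.MvPolynomial.CommRing
import Mathlib.Algebra.MvPolynomial.Eval
import Mathlib.RingTheory.Ideal.Quotient.Operations
import Mathlib.Data.ZMod.Basic
import Mathlib.Analysis.SpecialFunctions.Pow.Real
import Mathlib.Analysis.SpecialFunctions.Sqrt
import Mathlib.Tactic.FinCases
import Summits.Ventures.DiscreteObjects.UnitDistance.UnitCircleGraph
import Summits.Ventures.DiscreteObjects.UnitDistance.FiniteFieldObstruction
import HarnessLib

/-!
# The census coordinate ring `ℤ[1/6][√3, √5, √11]` reduces to `F₁₁`: every unit-distance graph with coordinates in it is 5-colourable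

Framing (verbatim for the cell): lottery ticket; floor = certified bounds/negative ranges.

This file completes, for the coordinate ring actually used by the (U) census (and by de Grey's and Heule's constructions:
all coordinates are polynomial in `√3, √5, √11` with denominators `2^a 3^b`), the kernel-checked form of the FIELD OBSTRUCTION
(`pub-namedobj-udg-g2/FIELD-OBSTRUCTION.md`): the ring `A = ℤ[x₀,…,x₄]/(x₀²−3, x₁²−5, x₂²−11, 2x₃−1, 3x₄−1)` has a ring
homomorphism `toZMod11 : A →+* ZMod 11` (`√3 ↦ 5, √5 ↦ 4, √11 ↦ 0, 1/2 ↦ 6, 1/3 ↦ 4`) and an honest real embedding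
`toReal : A →+* ℝ`; by `UnitCircleGraph.homUnitCircleGraphOfRingHom` and `FiniteFieldObstruction.udF11_colorable_five`,
EVERY graph whose vertices carry `A`-coordinates with adjacent vertices at unit distance is 5-colourable
(`colorable_five_of_coordRing`, no hypotheses left), while `toReal` shows these are genuine unit distances in the plane
(`real_unit_distance_of_coordRing`).  Consequently no 6-chromatic unit-distance graph can be built with such coordinates —
which closes families F1/F2/W3mix/TH/FL/TRI2 of the census for target (U).  (For arbitrary elements of `ℚ(√3,√5,√11)` one
translates each connected component to 11-integral coordinates first; that elementary step and `χ = 5` exactly — lower bound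
by Heule's graph — are in the md file, not here.)
-/

noncomputable section

namespace Summit.Ventures.DiscreteObjects.UnitDistance

open SimpleGraph MvPolynomial

/-- `ZMod 11` is nontrivial (needed for `Nontrivial (ZMod 11)` via `Fact (1 < 11)`). -/
instance fact_one_lt_eleven : Fact (1 < 11) := ⟨by decide⟩

/-- The finite-plane graph of `FiniteFieldObstruction.lean` IS the unit-circle graph of the ring `ZMod 11`. -/
theorem udF11_eq_unitCircleGraph : udF11 = unitCircleGraph (ZMod 11) := rfl

/-- Hence `unitCircleGraph (ZMod 11)` is 5-colourable (kernel computation in `FiniteFieldObstruction.lean`). -/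
theorem unitCircleGraph_zmod11_colorable_five : (unitCircleGraph (ZMod 11)).Colorable 5 :=
  udF11_eq_unitCircleGraph ▸ udF11_colorable_five

/-! ### The coordinate ring `A = ℤ[x₀,…,x₄]/(x₀² − 3, x₁² − 5, x₂² − 11, 2x₃ − 1, 3x₄ − 1) ≅ ℤ[1/6][√3, √5, √11]` -/

/-- Images of the generators in `ZMod 11`: `√3 ↦ 5`, `√5 ↦ 4`, `√11 ↦ 0`, `1/2 ↦ 6`, `1/3 ↦ 4`. -/
def gensZMod11 : Fin 5 → ZMod 11 := ![5, 4, 0, 6, 4]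

/-- Images of the generators in `ℝ`. -/
noncomputable def gensReal : Fin 5 → ℝ := ![Real.sqrt 3, Real.sqrt 5, Real.sqrt 11, 1 / 2, 1 / 3]

/-- The five defining relations. -/
def coordRel : Fin 5 → MvPolynomial (Fin 5) ℤ
  | 0 => X 0 ^ 2 - C 3
  | 1 => X 1 ^ 2 - C 5
  | 2 => X 2 ^ 2 - C 11
  | 3 => C 2 * X 3 - 1
  | 4 => C 3 * X 4 - 1

/-- The ideal of relations. -/
def coordIdeal : Ideal (MvPolynomial (Fin 5) ℤ) := Ideal.span (Set.range coordRel)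

/-- The coordinate ring of the census: `ℤ[1/6][√3, √5, √11]` presented by generators and relations. -/
abbrev CoordRing : Type := MvPolynomial (Fin 5) ℤ ⧸ coordIdeal

/-- Each defining relation vanishes at the chosen generator images in `ZMod 11`. -/
theorem eval_coordRel_zmod11 (i : Fin 5) : eval₂Hom (Int.castRingHom (ZMod 11)) gensZMod11 (coordRel i) = 0 := by
  fin_cases i <;> simp [coordRel, gensZMod11] <;> decide

/-- Each defining relation vanishes at the chosen generator images in `ℝ`. -/
theorem eval_coordRel_real (i : Fin 5) : eval₂Hom (Int.castRingHom ℝ) gensReal (coordRel i) = 0 := by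
  fin_cases i <;> simp [coordRel, gensReal]

/-- Reduction modulo the prime above 11: `A →+* ZMod 11`. -/
def toZMod11 : CoordRing →+* ZMod 11 :=
  Ideal.Quotient.lift coordIdeal (eval₂Hom (Int.castRingHom (ZMod 11)) gensZMod11) (by
    intro a ha
    refine (Ideal.span_le (I := RingHom.ker (eval₂Hom (Int.castRingHom (ZMod 11)) gensZMod11))).2 ?_ ha
    rintro _ ⟨i, rfl⟩
    exact eval_coordRel_zmod11 i)

/-- The real embedding `A →+* ℝ` (`x₀ ↦ √3`, …, `x₄ ↦ 1/3`): it is what makes `A`-coordinates honest plane coordinates. -/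
noncomputable def toReal : CoordRing →+* ℝ :=
  Ideal.Quotient.lift coordIdeal (eval₂Hom (Int.castRingHom ℝ) gensReal) (by
    intro a ha
    refine (Ideal.span_le (I := RingHom.ker (eval₂Hom (Int.castRingHom ℝ) gensReal))).2 ?_ ha
    rintro _ ⟨i, rfl⟩
    exact eval_coordRel_real i)

/-- MAIN THEOREM (no hypotheses beyond the coordinatisation): every graph whose vertices carry coordinates in the census coordinate ring `A` with adjacent
vertices at unit distance (`(Δx)² + (Δy)² = 1` in `A`) is 5-colourable. -/
theorem colorable_five_of_coordRing {V : Type*} {G : SimpleGraph V} (p : V → CoordRing × CoordRing)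
    (hadj : ∀ ⦃v w : V⦄, G.Adj v w → ((p v).1 - (p w).1) ^ 2 + ((p v).2 - (p w).2) ^ 2 = 1) : G.Colorable 5 :=
  unitCircleGraph_zmod11_colorable_five.of_hom (homUnitCircleGraphOfRingHom p hadj toZMod11)

/-- Geometric honesty: under the real embedding, adjacent vertices are at Euclidean distance `1`
(squared-distance form). -/
theorem real_unit_distance_of_coordRing {V : Type*} {G : SimpleGraph V} (p : V → CoordRing × CoordRing)
    (hadj : ∀ ⦃v w : V⦄, G.Adj v w → ((p v).1 - (p w).1) ^ 2 + ((p v).2 - (p w).2) ^ 2 = 1)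
    {v w : V} (h : G.Adj v w) :
    (toReal (p v).1 - toReal (p w).1) ^ 2 + (toReal (p v).2 - toReal (p w).2) ^ 2 = 1 := by
  have := congrArg toReal (hadj h)
  simpa only [map_add, map_pow, map_sub, map_one] using this

end Summit.Ventures.DiscreteObjects.UnitDistance

end
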